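import Summits.AtomisticToContinuum.HydrodynamicLimit.Theorems.CollisionIsometryCLTMacroClosureBarycentricDefs
import Literature.Analysis.FunctionSpaces.TorusMollifier
import Literature.Analysis.FunctionSpaces.TorusConvolution
import Literature.Analysis.FunctionSpaces.TorusLatticeCellTranslation
import HarnessLib

/-!
# Vocabulary of the TWO-SCALE statics of the line `IdeatorTwoGen1Sketch` (crux `MacroClosure`,
stmt-AtomisticToContinuum-14870): box blocks, cells of shifted tilings, the two explicit kernel families

Definitions-only support file (`--supports stmt-AtomisticToContinuum-14870`) of the line lead (continuation c2)
extending `CollisionIsometryCLTMacroClosureBarycentricDefs` (namespace `MacroClosureLine`) by the objects in which the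
registered sub-goals of the lead's stub `Barycentric.stub_blockMGF_twoScale` (skeleton
`Cruxes/MacroClosure/Lines/IdeatorTwoGen1Sketch.lean`, reshaped 2026-08-17) are stated, so that each can land in its
own Theorems file:

* `twoBand σ c₁ c₂ φ φ₂ N` — the two-scale band event (all `φ`-blocks AND all `φ₂`-blocks in their a-priori bands)
  and `BlockMGFTwoScale φ φ₂` — the two-scale homogeneous sub-unit block MGF of a pair of kernel families (verbatim
  the last conjunct of the registered `stub_blockMGF_twoScale`);
* `inCube ℓ y` / `boxKernel ℓ` — the half-open cube of side `ℓ` with LOWER corner `0` (in the fundamental-domain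
  coordinates `Torus.repr`) and its normalised indicator `ℓ⁻³ 𝟙`; `bU (boxKernel ℓ) z x` is the block state of the
  cube with lower corner `x`;
* `cellSet ℓ z x` / `cellCount ℓ z x` — the (index set / number of) particles of a configuration in that cube;
  `cellKin uc θc ℓ z x` — `n ×` the kinetic Bregman density of the cube (sum of squares about the mean + drift,
  the integrand of the landed `stub_gaussCellMGF`); `confRate σ uc θc r` — the configurational Bregman density
  `h_σ(stateOf r u_c θ_c | stateOf 1 u_c θ_c)`;
* `mesh N` (`= 64 (⌊(N+1)^{1/15}⌋ + 1)`), `side N = 1/mesh N`, the box-smoothed family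
  `boxFamily N = boxKernel (side N) ⋆ Torus.kernel (side N/8)` and the fine mollifier family
  `fineFamily N = Torus.kernel (side N/128)` (the witnesses of `stub_blockMGF_twoScale`); the lower corners of the
  cells of the `x`-shifted tiling are `x + Torus.proj (Torus.cellCorner (mesh N) κ)`, `κ : Fin 3 → Fin (mesh N)`.

Nothing is asserted (every `def` is an object or a statement, never a hypothesis taken as a fact).
-/

noncomputable section

open MeasureTheory Filter Set Topology InformationTheory
open scoped ENNReal ContDiff Convolution

namespace Summit.AtomisticToContinuum.HydrodynamicLimit.Theorems.MacroClosureLine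

open Literature.MathematicalPhysics.KineticTheory Literature.Analysis.FluidPDE
open Literature.Analysis.FunctionSpaces

/-! ## The two-scale band and the two-scale block MGF -/

/-- The TWO-SCALE band event of a configuration of `N + 1` spheres: every `φ`-block has density in
`[c₁, σ⁻³]` and every `φ₂`-block has density in `[c₂, σ⁻³]`. -/
def twoBand (σ c₁ c₂ : ℝ) (φ φ₂ : T3 → ℝ) (N : ℕ) : Set (Config (N + 1) (Fin 3) T3) :=
  {z | (∀ x, c₁ ≤ bρ φ z x ∧ bρ φ z x * σ ^ 3 ≤ 1) ∧ (∀ x, c₂ ≤ bρ φ₂ z x ∧ bρ φ₂ z x * σ ^ 3 ≤ 1)}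

/-- STATICS A₂ — **the two-scale homogeneous sub-unit block MGF** of a pair of kernel families `(φ, φ₂)`: under
the homogeneous canonical law `localGibbsLaw σ 1 u_c θ_c` (flow-invariant), for all band floors `c₁, c₂ > 0`, every
tilt `γ' < 1` and every `ε > 0`, eventually in `N` and for all flows,
`E exp(γ'(N+1) 𝟙{two-scale band} ∫ₓ h_σ⁺(Ū_φ(z,x) | U_c) dx) ≤ e^{ε(N+1)}` (verbatim the last conjunct of the
registered `stub_blockMGF_twoScale`; stated with `∫⁻`, so an infinite moment falsifies it). -/
def BlockMGFTwoScale (φ φ₂ : ℕ → T3 → ℝ) : Prop :=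
  ∃ σ₀ : ℝ, 0 < σ₀ ∧ ∀ σ : ℝ, 0 < σ → σ < σ₀ → ∀ (uc : V3) (θc : ℝ), 0 < θc →
    ∀ c₁ : ℝ, 0 < c₁ → ∀ c₂ : ℝ, 0 < c₂ → ∀ γ' : ℝ, 0 < γ' → γ' < 1 → ∀ ε : ℝ, 0 < ε →
    ∀ᶠ N : ℕ in atTop, ∀ Φ : Flow σ N,
      ∫⁻ z, ENNReal.ofReal (Real.exp (γ' * ((N : ℝ) + 1) *
          {z : Config (N + 1) (Fin 3) T3 |
              (∀ x, c₁ ≤ bρ (φ N) z x ∧ bρ (φ N) z x * σ ^ 3 ≤ 1) ∧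
              (∀ x, c₂ ≤ bρ (φ₂ N) z x ∧ bρ (φ₂ N) z x * σ ^ 3 ≤ 1)}.indicator
            (fun z => ∫ x, max 0 (relEnt σ (bU (φ N) z x) (stateOf 1 uc θc))) z))
        ∂(localGibbsLaw σ (fun _ => 1) (fun _ => uc) (fun _ => θc) N Φ) ≤
      ENNReal.ofReal (Real.exp (ε * ((N : ℝ) + 1)))

/-! ## Box blocks and cells -/

/-- Membership of a point of `𝕋³` in the half-open cube of side `ℓ` with lower corner `0`, in fundamental-domain
coordinates: `repr y ∈ [0, ℓ)³`. -/
def inCube (ℓ : ℝ) (y : T3) : Prop := ∀ l, Torus.repr y l < ℓ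

/-- The BOX KERNEL of side `ℓ`: the normalised indicator `ℓ⁻³ 𝟙{repr y ∈ [0,ℓ)³}` (unit mass for `ℓ ≤ 1`;
`bU (boxKernel ℓ) z x` is the block state of the cube of side `ℓ` with lower corner `x`). -/
def boxKernel (ℓ : ℝ) (y : T3) : ℝ := {y : T3 | inCube ℓ y}.indicator (fun _ => (ℓ ^ 3)⁻¹) y

section Cells

variable {N : ℕ}

/-- The indices of the particles of `z` lying in the cube of side `ℓ` with lower corner `x`. -/
def cellSet (ℓ : ℝ) (z : Config (N + 1) (Fin 3) T3) (x : T3) : Finset (Fin (N + 1)) :=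
  @Finset.filter _ (fun i => inCube ℓ ((z i).1 - x)) (fun _ => Classical.propDecidable _) Finset.univ

/-- The number of particles of `z` in the cube of side `ℓ` with lower corner `x`. -/
def cellCount (ℓ : ℝ) (z : Config (N + 1) (Fin 3) T3) (x : T3) : ℕ := (cellSet ℓ z x).card

/-- `n ×` the KINETIC Bregman density of the cube of side `ℓ` with lower corner `x` against the homogeneous state
`(u_c, θ_c)`: with `S` the cell's indices, `n = #S`, `SS = Σ_S ‖vᵢ‖² − ‖Σ_S vᵢ‖²/n` (`= 3nθ̄`) and
`D = ‖Σ_S vᵢ − n u_c‖²/n` (`= n‖v̄ − u_c‖²`): `(SS + D)/(2θ_c) − (3n/2)(1 + log(SS/(3nθ_c)))`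
(`= n[(3/2)(θ̄/θ_c − 1 − log(θ̄/θ_c)) + ‖v̄ − u_c‖²/(2θ_c)]`; the integrand of `stub_gaussCellMGF`). -/
def cellKin (uc : V3) (θc ℓ : ℝ) (z : Config (N + 1) (Fin 3) T3) (x : T3) : ℝ :=
  (((∑ i ∈ cellSet ℓ z x, ‖(z i).2‖ ^ 2) - ‖∑ i ∈ cellSet ℓ z x, (z i).2‖ ^ 2 / (cellCount ℓ z x : ℝ)) +
      ‖(∑ i ∈ cellSet ℓ z x, (z i).2) - (cellCount ℓ z x : ℝ) • uc‖ ^ 2 / (cellCount ℓ z x : ℝ)) / (2 * θc) -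
    3 * (cellCount ℓ z x : ℝ) / 2 *
      (1 + Real.log (((∑ i ∈ cellSet ℓ z x, ‖(z i).2‖ ^ 2) -
        ‖∑ i ∈ cellSet ℓ z x, (z i).2‖ ^ 2 / (cellCount ℓ z x : ℝ)) / (3 * (cellCount ℓ z x : ℝ) * θc)))

end Cells

/-- The CONFIGURATIONAL Bregman density at density `r` against the homogeneous state of density `1`:
`h_σ(stateOf r u_c θ_c | stateOf 1 u_c θ_c)` (`= r log r − r + 1 +` the Bregman divergence of `r ↦ r f_ex(rσ³)`
at `1`; independent of `u_c, θ_c` in the dilute chamber, `relEnt_stateOf`). -/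
def confRate (σ : ℝ) (uc : V3) (θc r : ℝ) : ℝ := relEnt σ (stateOf r uc θc) (stateOf 1 uc θc)

/-! ## The two explicit kernel families -/

/-- The mesh of the box family: `64 (⌊(N+1)^{1/15}⌋ + 1)` cubes per axis. -/
def mesh (N : ℕ) : ℕ := 64 * (⌊((N : ℝ) + 1) ^ (1 / 15 : ℝ)⌋₊ + 1)

/-- The mesh is positive. -/
theorem mesh_pos : ∀ N : ℕ, 0 < mesh N := fun N => by
  unfold mesh; positivity

/-- The side `ℓ_N = 1 / mesh N` of the boxes. -/
def side (N : ℕ) : ℝ := ((mesh N : ℕ) : ℝ)⁻¹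

/-- The BOX-SMOOTHED admissible family `φ_N = b_{ℓ_N} ⋆ ρ_{ℓ_N/8}`: the box kernel of side `ℓ_N` mollified by the
torus mollifier `Torus.kernel` of radius `ℓ_N/8` (`(b ⋆ ψ)(y) = ∫ b(w) ψ(y − w) dw`, smooth by
`Torus.isSmooth_convolution`; its block state is the `ψ`-average of box block states, `bU φ z x = ∫ ψ(w) • bU b z (x + w) dw`). -/
def boxFamily (N : ℕ) : T3 → ℝ := boxKernel (side N) ⋆ Torus.kernel (d := Fin 3) (side N / 8)

/-- The FINE mollifier family `φ₂,N = ρ_{ℓ_N/128}` (torus mollifier of radius `ℓ_N/128`; its a-priori band floors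
AND ceilings the occupation of every cube of side `ℓ_N`). -/
def fineFamily (N : ℕ) : T3 → ℝ := Torus.kernel (d := Fin 3) (side N / 128)

end Summit.AtomisticToContinuum.HydrodynamicLimit.Theorems.MacroClosureLine

end
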